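import Mathlib

/-!
# DualCertificateLawNewton — plan-lens-HodgeAV-dual g8: the (R4)-AWARE two-term road at h = 14, kernel-checked arithmetic

Companion to `DUAL-CERT-FAMILY-g8.md` (dual g8, director order R19.399: «put (R4) INTO the Benders master so that
what comes out is class-clean»).  EVIDENCE-LEVEL bookkeeping only: nothing in this file is a rung or bears on
18881 / H2 / HC_AV / HC_CM / HC; it proves no statement about the crux `BlochSeedDiscOne`.

What is checked here (all elementary):
* `twist_psum` — TWIST COVARIANCE of the rank-4 Newton closure (R4): with `λ'_d := Σ_j C(d,j) (−h)^{d−j} λ_j`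
  (the class frame in which the hub cell `N[hI|hI|hI|hI]` is `(1,0,…,0)`), `λ_j = p_j(x)` for `j ≤ d` gives
  `λ'_d = p_d(x − h)`; so (R4) reads `λ'_d = p_d(y)` (`d ≤ 7`), `λ'_8 = p_8(y) + |μ|²/140`, `y = x − h`.
* `hub_accounting`, `rank_budget` — the exact hub accounting of the two-term flow model
  (`rank = U + n_hub − G`; rank 4 with `G ≤ n_hub` ⟺ a surplus `s ≥ 0` with `U + s = 4`), correcting the g6
  slack-4 cone which charged the hub flow `G` to the budget.
* `mu_granularity`, `fourteen_dvd_of_280`, `norm_ge_1960` — the μ-arithmetic of the CLASS LATTICE of orbit-constant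
  integer designs at h = 14 (lattice.py: fibre of `Λ'_U` over `(λ'_1..λ'_7)` is a coset of `512ℤ × 16ℤ × 16ℤ` in
  `(λ'_8, Re μ, Im μ)`, both on B4h14 and B6h14): `Re μ ∈ 4ℤ, Im μ ∈ 16ℤ, 140 ∣ |μ|²` force `Re μ ∈ 28ℤ, Im μ ∈ 112ℤ`;
  on the all-roots-at-h slice (`y = 0`: `Re, Im ∈ 16ℤ`, `|μ|² ∈ 140·512ℤ`) a nonzero μ has `|μ|² ≥ 256·1960 = 501760`,
  i.e. `|μ| > 708`, against LP windows `|Im μ| ≤ 89.58 / 239.5`, `Re μ ≤ 112.1 / 242.2` (B4h14 / B6h14): the slice is dead.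
* numeric sanity of the certificate table of the memo (`norm_num`).
-/

namespace Summit.HodgeConjecture.HodgeConjecture.Cruxes.BlochSeedDiscOne.DualCertificateLawNewton

open Finset

/-- power sums of four formal roots. -/
def psum (y₁ y₂ y₃ y₄ : ℚ) (d : ℕ) : ℚ := y₁ ^ d + y₂ ^ d + y₃ ^ d + y₄ ^ d

/-- one root: `(x − h)^d = Σ_{j ≤ d} C(d,j) (−h)^{d−j} x^j` (binomial theorem). -/
theorem twist_pow (x h : ℚ) (d : ℕ) :
    ∑ j ∈ range (d + 1), (Nat.choose d j : ℚ) * (-h) ^ (d - j) * x ^ j = (x - h) ^ d := by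
  rw [sub_eq_add_neg, add_pow]
  refine Finset.sum_congr rfl (fun j _ => ?_)
  ring

/-- TWIST COVARIANCE of (R4): `Σ_j C(d,j) (−h)^{d−j} p_j(x) = p_d(x − h)` for every `d`. -/
theorem twist_psum (x₁ x₂ x₃ x₄ h : ℚ) (d : ℕ) :
    ∑ j ∈ range (d + 1), (Nat.choose d j : ℚ) * (-h) ^ (d - j) * psum x₁ x₂ x₃ x₄ j
      = psum (x₁ - h) (x₂ - h) (x₃ - h) (x₄ - h) d := by
  simp only [psum, mul_add, Finset.sum_add_distrib, twist_pow]

/-- the μ-term of (R4) is twist-invariant: twisting the sequence `(0,…,0,c)` (a constant in degree 8 only) leaves `c`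
in degree 8 — the `j = 8` binomial coefficient is `1` and `(−h)^0 = 1`. -/
theorem twist_top (c h : ℚ) :
    ∑ j ∈ range (8 + 1), (Nat.choose 8 j : ℚ) * (-h) ^ (8 - j) * (if j = 8 then c else 0) = c := by
  simp

/-- EXACT HUB ACCOUNTING of the two-term flow model: with `F` = mass moved along live P→N pairs, `G` = P→hub flow,
`U` = unsaturated N mass, `n` = hub copies, `Σ_N − Σ_P = (F + U + n) − (F + G)`. -/
theorem hub_accounting (F G U n : ℤ) : (F + U + n) - (F + G) = U + n - G := by ring

/-- cokernel rank 4 with the hub absorbing its inflow (`G ≤ n`) ⟺ a surplus `s = n − G ≥ 0` with `U + s = 4`: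
the rank budget charges unsaturated N mass and SURPLUS hub copies only (not the hub flow `G`). -/
theorem rank_budget (G U n : ℤ) (hG : G ≤ n) :
    U + n - G = 4 ↔ ∃ s : ℤ, 0 ≤ s ∧ n = G + s ∧ U + s = 4 := by
  constructor
  · intro h; exact ⟨n - G, by omega, by omega, by omega⟩
  · rintro ⟨s, _, hn, hU⟩; omega

/-- residues: `x² + y² ≡ 0 (mod 7)` forces `x ≡ y ≡ 0`. -/
theorem zmod7_sq_add_sq : ∀ x y : ZMod 7, x ^ 2 + y ^ 2 = 0 → x = 0 ∧ y = 0 := by decide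

/-- residues: `(4x)² + (16y)² ≡ 0 (mod 7)` forces `x ≡ y ≡ 0`. -/
theorem zmod7_granular : ∀ x y : ZMod 7, (4 * x) ^ 2 + (16 * y) ^ 2 = 0 → x = 0 ∧ y = 0 := by decide

/-- residues: `x² + y² ≡ 0 (mod 8)` forces `x, y` even. -/
theorem zmod8_sq_add_sq : ∀ x y : ZMod 8, x ^ 2 + y ^ 2 = 0 → 2 ∣ x.val ∧ 2 ∣ y.val := by decide

/-- μ-GRANULARITY under (R4) on the h = 14 class lattices: `Re μ = 4i`, `Im μ = 16j` (coordinate gcds of `Λ'_U`)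
and `140 ∣ |μ|²` (`λ'_8 − p_8 = |μ|²/140 ∈ ℤ`) force `7 ∣ i` and `7 ∣ j`, i.e. `Re μ ∈ 28ℤ`, `Im μ ∈ 112ℤ`. -/
theorem mu_granularity (i j : ℤ) (h : (140:ℤ) ∣ (4 * i) ^ 2 + (16 * j) ^ 2) : (7:ℤ) ∣ i ∧ (7:ℤ) ∣ j := by
  have h7 : (7:ℤ) ∣ (4 * i) ^ 2 + (16 * j) ^ 2 := dvd_trans (by norm_num) h
  have hz : ((4 : ZMod 7) * (i : ZMod 7)) ^ 2 + (16 * (j : ZMod 7)) ^ 2 = 0 := by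
    have := (ZMod.intCast_zmod_eq_zero_iff_dvd ((4 * i) ^ 2 + (16 * j) ^ 2) 7).mpr h7
    push_cast at this
    exact this
  obtain ⟨hi, hj⟩ := zmod7_granular _ _ hz
  exact ⟨(ZMod.intCast_zmod_eq_zero_iff_dvd i 7).mp hi, (ZMod.intCast_zmod_eq_zero_iff_dvd j 7).mp hj⟩

/-- consequence: a nonzero imaginary part is at least 112 in absolute value. -/
theorem im_ge_112 (i j : ℤ) (h : (140:ℤ) ∣ (4 * i) ^ 2 + (16 * j) ^ 2) (hj : j ≠ 0) :
    (112:ℤ) ≤ |16 * j| := by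
  obtain ⟨-, ⟨k, rfl⟩⟩ := mu_granularity i j h
  have hk : k ≠ 0 := by rintro rfl; simp at hj
  rw [abs_mul, abs_mul]
  have : (1:ℤ) ≤ |k| := Int.one_le_abs hk
  norm_num
  nlinarith [abs_nonneg k]

/-- parity from `4 ∣ a² + b²`: an odd `a` gives `a² + b² ≡ 1 or 2 (mod 4)`. -/
theorem two_dvd_of_four_dvd_sq_add_sq (a b : ℤ) (h : (4:ℤ) ∣ a ^ 2 + b ^ 2) : (2:ℤ) ∣ a := by
  rcases Int.even_or_odd a with ha | ⟨k, hk⟩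
  · exact even_iff_two_dvd.mp ha
  · exfalso
    obtain ⟨c, hc⟩ := h
    rcases Int.even_or_odd b with ⟨m, hm⟩ | ⟨m, hm⟩
    · subst hk; subst hm
      have e : (2 * k + 1) ^ 2 + (m + m) ^ 2 = 4 * (k ^ 2 + k + m ^ 2) + 1 := by ring
      rw [e] at hc; generalize k ^ 2 + k + m ^ 2 = S at hc; omega
    · subst hk; subst hm
      have e : (2 * k + 1) ^ 2 + (2 * m + 1) ^ 2 = 4 * (k ^ 2 + k + m ^ 2 + m) + 2 := by ring
      rw [e] at hc; generalize k ^ 2 + k + m ^ 2 + m = S at hc; omega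

/-- the all-roots-at-h slice (`y = 0`): there the fibre of the class lattice is `512ℤ × 16ℤ × 16ℤ` itself, so
`Re μ = 16a`, `Im μ = 16b` and (R4) `|μ|² = 140 λ'_8 ∈ 140·512ℤ`, i.e. `256(a²+b²) ∈ 71680ℤ`, `a² + b² ∈ 280ℤ`.
Step 1: `280 ∣ a² + b²` forces `14 ∣ a` and `14 ∣ b`. -/
theorem fourteen_dvd_of_280 (a b : ℤ) (h : (280:ℤ) ∣ a ^ 2 + b ^ 2) : (14:ℤ) ∣ a ∧ (14:ℤ) ∣ b := by
  have h7 : (7:ℤ) ∣ a ^ 2 + b ^ 2 := dvd_trans (by norm_num) h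
  have h4 : (4:ℤ) ∣ a ^ 2 + b ^ 2 := dvd_trans (by norm_num) h
  have h4' : (4:ℤ) ∣ b ^ 2 + a ^ 2 := by rwa [add_comm]
  have hz7 : ((a : ZMod 7)) ^ 2 + ((b : ZMod 7)) ^ 2 = 0 := by
    have := (ZMod.intCast_zmod_eq_zero_iff_dvd (a ^ 2 + b ^ 2) 7).mpr h7
    push_cast at this; exact this
  obtain ⟨ha7, hb7⟩ := zmod7_sq_add_sq _ _ hz7
  have ha7' : (7:ℤ) ∣ a := (ZMod.intCast_zmod_eq_zero_iff_dvd a 7).mp ha7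
  have hb7' : (7:ℤ) ∣ b := (ZMod.intCast_zmod_eq_zero_iff_dvd b 7).mp hb7
  have ha2 := two_dvd_of_four_dvd_sq_add_sq a b h4
  have hb2 := two_dvd_of_four_dvd_sq_add_sq b a h4'
  have hc : IsCoprime (2:ℤ) 7 := by rw [Int.isCoprime_iff_gcd_eq_one]; decide
  exact ⟨by simpa using hc.mul_dvd ha2 ha7', by simpa using hc.mul_dvd hb2 hb7'⟩

/-- Step 2: hence a nonzero `(a, b)` with `280 ∣ a² + b²` has `a² + b² ≥ 1960` (`a = 14α, b = 14β`,
`196(α²+β²) ∈ 280ℤ ⇒ 10 ∣ α²+β² ⇒ α²+β² ≥ 10`); so `|μ|² = 256(a²+b²) ≥ 501760`, `|μ| > 708`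
(`1960 = 14² + 42²` is attained: `μ = ±224 ± 672 i` and its transposes are the smallest nonzero classes). -/
theorem norm_ge_1960 (a b : ℤ) (h : (280:ℤ) ∣ a ^ 2 + b ^ 2) (hab : a ≠ 0 ∨ b ≠ 0) :
    (1960:ℤ) ≤ a ^ 2 + b ^ 2 := by
  obtain ⟨⟨α, rfl⟩, ⟨β, rfl⟩⟩ := fourteen_dvd_of_280 a b h
  obtain ⟨c, hc⟩ := h
  have e : (14 * α) ^ 2 + (14 * β) ^ 2 = 196 * (α ^ 2 + β ^ 2) := by ring
  have h7X : (10:ℤ) ∣ 7 * (α ^ 2 + β ^ 2) := ⟨c, by linarith [hc, e]⟩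
  have hcop : IsCoprime (10:ℤ) 7 := by rw [Int.isCoprime_iff_gcd_eq_one]; decide
  have h10 : (10:ℤ) ∣ α ^ 2 + β ^ 2 := hcop.dvd_of_dvd_mul_left h7X
  have hpos : (0:ℤ) < α ^ 2 + β ^ 2 := by
    rcases hab with ha | hb
    · have : α ≠ 0 := by rintro rfl; simp at ha
      positivity
    · have : β ≠ 0 := by rintro rfl; simp at hb
      positivity
  obtain ⟨d, hd⟩ := h10
  have hd1 : (1:ℤ) ≤ d := by
    generalize α ^ 2 + β ^ 2 = X at hd hpos; omega
  rw [e, hd]; linarith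

example : (14:ℤ) ^ 2 + 42 ^ 2 = 1960 ∧ (280:ℤ) ∣ 1960 ∧ (224:ℤ) ^ 2 + 672 ^ 2 = 501760 := by norm_num

/-- numeric sanity for the memo's certificate table (orbit-admissible μ at h = 14; the y = 0 floor; LP windows). -/
example : (56:ℤ) ^ 2 + 112 ^ 2 = 140 * 112 ∧ (84:ℤ) ^ 2 + 112 ^ 2 = 140 * 140 ∧ (224:ℤ) ^ 2 + 112 ^ 2 = 140 * 448
    ∧ (256:ℤ) * 1960 = 501760 ∧ (501760:ℤ) = 140 * (7 * 512) ∧ (708:ℤ) ^ 2 < 501760 := by norm_num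
/-- the y = 0 LP windows of record (exact rationals rounded outward) lie far below the lattice floor 708:
B4h14 `|Im μ| ≤ 89.58`, `Re μ ≤ 112.1`; B6h14 `|Im μ| ≤ 239.5`, `Re μ ≤ 242.2`; even `|μ|² ≤ 242.2² + 239.5² < 501760`. -/
example : (2422:ℚ) ^ 2 / 100 + (2395:ℚ) ^ 2 / 100 < 501760 := by norm_num

/-! ## The one LP-alive (R4)-clean class target of g8 (memo §5c) — kernel arithmetic of its Newton data
Universe B6h14, Newton data `e = (e₁,e₂,e₃,e₄) = (0, 8, 0, 10)`, i.e. the four formal roots `y = x − 14` of the rank-4 target satisfy `y⁴ + 8y² + 10 = 0`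
(Eisenstein at 2, hence irreducible over ℚ — recorded in the memo, not formalised here).  Newton's identities with `e₁ = e₃ = 0`:
`p₂ = −2e₂`, `p₄ = −e₂p₂ − 4e₄`, `p₆ = −e₂p₄ − e₄p₂`, `p₈ = −e₂p₆ − e₄p₄`, odd sums vanish; the (R4) top-degree correction is `|μ|²/140` with `μ = 56 + 112 i`. -/

/-- power sums of the roots of `y⁴ + 8y² + 10`: `(p₂, p₄, p₆, p₈) = (−16, 88, −544, 3472)`. -/
theorem aliveTarget_newton :
    (-(2:ℤ) * 8 = -16) ∧ (-(8:ℤ) * (-16) - 4 * 10 = 88) ∧ (-(8:ℤ) * 88 - 10 * (-16) = -544) ∧ (-(8:ℤ) * (-544) - 10 * 88 = 3472) := by norm_num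

/-- the (R4) class of the target: `λ'₈ = p₈ + |μ|²/140 = 3472 + 112 = 3584` for `μ = 56 + 112 i` (`|μ|² = 15680 = 140·112`), and μ obeys the lattice law
(`Re μ ∈ 28ℤ`, `Im μ ∈ 112ℤ`). -/
theorem aliveTarget_class :
    (56:ℤ) ^ 2 + 112 ^ 2 = 140 * 112 ∧ (3472:ℤ) + 112 = 3584 ∧ (28:ℤ) ∣ 56 ∧ (112:ℤ) ∣ 112 ∧ (16:ℤ) ∣ (-16) ∧ (4:ℤ) ∣ 88 ∧ (16:ℤ) ∣ (-544) := by norm_num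

/-- the target μ sits inside the exact LP window at this e (`Re μ ≤ 75224907883147792416/420141113267700511 ≈ 179.05`, `Im μ ≤ 2654497443041/12768701452 ≈ 207.89`)
while its associate `−56 + 112 i` violates `Re μ ≥ −3942075357485118976/830600403342664197 ≈ −4.746` (and is LP-DEAD by a Farkas vector of record). -/
example : (56:ℚ) < 75224907883147792416 / 420141113267700511 ∧ (112:ℚ) < 2654497443041 / 12768701452
    ∧ -(3942075357485118976:ℚ) / 830600403342664197 > -56 := by norm_num

/-! ## (Withdrawn model) the fixed-word «cell lattice» — arithmetic kept, reading corrected (memo §6b rev 6)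
Rev 2–5 of the memo modelled non-orbit-constant designs by the fixed-representative-word class vector and a lattice L_cell with HNF diagonal
(1,1,1,1,1,4,16,64,256,1,2), and read the orbit-level Newton form of (R4) on it.  That reading is WITHDRAWN: at cell level the class is a tensor
(e-free word moments are slot-dependent) and (R4) does not reduce to the nine-number Newton law.  The arithmetic below is still true as stated
(`35840 ∣ a² + b²`, `(a,b) ≠ 0` ⇒ `a² + b² ≥ 250880`) but is no longer used for any verdict: -/

/-- (model arithmetic, no longer a verdict) `35840 ∣ a² + b²` and `(a,b) ≠ 0` force `a² + b² ≥ 250880` (`|μ| ≥ 500.88`). -/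
theorem cell_norm_floor (a b : ℤ) (h : (35840:ℤ) ∣ a ^ 2 + b ^ 2) (hab : a ≠ 0 ∨ b ≠ 0) :
    (250880:ℤ) ≤ a ^ 2 + b ^ 2 := by
  have h280 : (280:ℤ) ∣ a ^ 2 + b ^ 2 := dvd_trans ⟨128, by norm_num⟩ h
  obtain ⟨⟨α, rfl⟩, ⟨β, rfl⟩⟩ := fourteen_dvd_of_280 _ _ h280
  obtain ⟨k, hk⟩ := h
  have e : (14 * α) ^ 2 + (14 * β) ^ 2 = 196 * (α ^ 2 + β ^ 2) := by ring
  have h7k : (7:ℤ) ∣ 1280 * k := ⟨α ^ 2 + β ^ 2, by linarith [hk, e]⟩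
  have hcop : IsCoprime (7:ℤ) 1280 := by rw [Int.isCoprime_iff_gcd_eq_one]; decide
  obtain ⟨m, hm⟩ := hcop.dvd_of_dvd_mul_left h7k
  have hpos : (0:ℤ) < α ^ 2 + β ^ 2 := by
    rcases hab with ha | hb
    · have : α ≠ 0 := by rintro rfl; simp at ha
      positivity
    · have : β ≠ 0 := by rintro rfl; simp at hb
      positivity
  have hm1 : (1:ℤ) ≤ m := by
    have : 196 * (α ^ 2 + β ^ 2) = 35840 * (7 * m) := by rw [← hm, ← hk, e]
    nlinarith
  rw [e]
  have : 196 * (α ^ 2 + β ^ 2) = 250880 * m := by have := hk; rw [hm] at this; linarith [this, e]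
  linarith

/-- (model arithmetic) `242.2² + 239.5² < 250880`; `250880 = 35840·7 = 140·256·7`. -/
example : (2422:ℚ) ^ 2 / 100 + (2395:ℚ) ^ 2 / 100 < 250880 ∧ (250880:ℤ) = 35840 * 7 ∧ (35840:ℤ) = 140 * 256 := by norm_num

/-! ## Budget integrality at the alive class (memo §6a)
In the flow model the rank budget reads `Σ_i U_i + s = 4`, where `U_i = u_i·|O_i|` is the number of UNSATURATED CELLS in the N orbit `O_i`
and `s` the surplus hub copies; for an orbit-constant integer design with an integer Hall flow `U_i, s ∈ ℕ` (the per-orbit multiplicities need not make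
`u_i = U_i/|O_i|` integral — unsaturated cells need not come in whole orbits).  Exact LPs at the alive class: `s = 1, 2, 3, 4` are all
Farkas-infeasible, so `s = 0`; the minimum P-mass with `s = 0` exceeds 30, so an integer design there has ≥ 31 P cells and ≥ 35 N cells.
The finer enumeration of the memo (50 patterns, 48 dead) concerns the SPECIAL case where the unsaturated cells are whole orbit copies
(`u_i ∈ ℕ`, e.g. when a G₁-symmetric integer flow exists): then `|O_i|·u_i ≤ 4` forces `|O_i| ≤ 4`, and the patterns are the 35 ordered
4-part compositions of 4 (three size-1 orbits and `s`) plus the 15 single size-4 orbits. -/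

/-- budget split: with `s ∈ ℕ`, `s ≤ 4`, and `s ≠ 0` refuted case by case (`s = 1, 2, 3, 4` Farkas-dead), `s = 0`. -/
theorem surplus_zero (s : ℕ) (hs : s ≤ 4) (h1 : s ≠ 1) (h2 : s ≠ 2) (h3 : s ≠ 3) (h4 : s ≠ 4) : s = 0 := by omega

/-- size floor at the alive class (orbit-constant integer designs): the exact LP minimum of the
P-mass with `s = 0` is `452012495050988188949 / 14863664485219968000 > 30`, hence ≥ 31 P cells, ≥ 35 N cells (`N = P + 4`), ≥ 66 cells. -/
theorem size_floor :
    (30:ℚ) < 452012495050988188949 / 14863664485219968000 ∧ ∀ P : ℕ, 30 < P → 66 ≤ P + (P + 4) := by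
  refine ⟨by norm_num, fun P hP => by omega⟩

/-- whole-orbit unsaturation (special case): `|O|·u ≤ 4` with `u ≥ 1` forces `|O| ≤ 4`. -/
theorem no_big_unsaturated_orbit_copy (O u : ℕ) (hu : 1 ≤ u) (h : O * u ≤ 4) : O ≤ 4 := by nlinarith

/-- a size-4 orbit can carry a whole unsaturated copy `u = 1` only, and then nothing else fits. -/
theorem size_four_orbit_pattern (u r : ℕ) (hu : 1 ≤ u) (h : 4 * u + r = 4) : u = 1 ∧ r = 0 := by omega

/-- ordered 4-part compositions of 4 (three size-1 orbit multiplicities and `s`): 35; with the 15 size-4 orbits, 50 whole-orbit patterns. -/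
theorem budget_compositions_card :
    ((Finset.range 5 ×ˢ Finset.range 5 ×ˢ Finset.range 5 ×ˢ Finset.range 5).filter
      (fun t : ℕ × ℕ × ℕ × ℕ => t.1 + t.2.1 + t.2.2.1 + t.2.2.2 = 4)).card = 35 := by decide

example : 35 + 15 = 50 ∧ 48 + 2 = 50 := by norm_num

end Summit.HodgeConjecture.HodgeConjecture.Cruxes.BlochSeedDiscOne.DualCertificateLawNewton
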